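import Literature.MathematicalPhysics.QuantumFieldTheory.Balaban1983to89.B9Thm311SitePrimeFormCoercive

/-!
# `Balaban1983to89.B9Thm311SitePrimeFormCoerciveCanonical` — T. Bałaban, *Propagators for lattice gauge theories in a background field*, Commun. Math.
# Phys. **99** (1985) 389–434 [Balaban1985BackgroundPropagators] (3.24)–(3.25) p. 394, (3.63)–(3.64) p. 402, Thm 3.11 p. 416, with [Balaban1983RegularityDecay]
# (2.27) p. 580: THE STRONG SITE COERCIVITY OF `Δ′_a(U)` AT A NEAR-FLAT BACKGROUND WITH THE LETTERS DISCHARGED ALONG BAŁABAN's NORMALISATION —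
# `(1∕(2 + 2∕a′) − θ′)·(‖D_1λ‖² + (ηL)⁻²‖λ‖²) ≤ re⟨λ, Δ′_{a′}(U)λ⟩`, `θ′ = √d·t + d·t² + a′ρ′s(2s + ρ′s)`, `t = ‖η⁻¹‖εR`, `s = (ηL)⁻¹`,
# `ρ′ = (1+εR)^{d(L−1)} − 1` — the sequel of `B9Thm311SitePrimeFormCoercive` (R2′ STEP B7′ S3b of `t4/ROUTES-NE9.md` v13.19)

statement-level skeleton of published theorems with citation tags; proofs where landed; nothing here is a claim about the Yang–Mills mass gap

PDF held and THE PRINT: as `B9Thm311SitePrimeFormCoercive` ([B9] pp. 394–395, 402, 416; [B4] p. 580).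

WHAT IS PROVED (sorry-free; 0 `def`; [folklore]; no inequality of the papers asserted).
* **`norm_Qtilde_sub_flat_le`** — the `Q′`-DEFECT in `laplacePrimeA`'s `c₁`-weighted currency: `‖Q̃′(U)λ − Q̃′(1)λ‖ ≤ ρ′·√(c₁∕(c₀L^d))·‖λ‖`
  ((ρ′) `B9Eq319QprimeLipschitz.sum_norm_sq_QprimeW_sub_flat_le` × `c₁`; NO centre lift, NO `√(L^d)`); **`norm_Qtilde_flat_le`** — `‖Q̃′(1)λ‖ ≤
  √(c₁∕(c₀L^d))·‖λ‖` (Jensen per block + the block partition).  Along `c₁(ηL)² = c₀L^d` both factors are `(ηL)⁻¹`.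
* **`strong_site_coercive_canonical`** — `B9Thm311SitePrimeFormCoercive.flat_site_strong_coercive` + `re_inner_laplacePrimeA_ge_flat_sub` with
  `δ_D = √d‖η⁻¹‖εR` (`B9Eq373DerivativeRemainderL2.norm_covDerivL2K_sub_le`), `δ_{Q′} = ρ′(ηL)⁻¹`, `M_{Q′} = (ηL)⁻¹`: the displayed inequality above,
  for ALL values of the letters (useful when `θ′ < 1∕(2 + 2∕a′)`); on the diagonal `ηL = 1` at `εR = K_Rαη`: `t = K_Rα`, `ρ′ ≤ dK_Rα·e^{dK_Rα}` — NO
  `η`, `L`, `m`, `c₀`, `c₁`.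
MODEL ∕ HONEST SCOPE.  As the parent file: (M2) DISPLAYED `hRS`, `εR`, the weight relation, `0 < ηL ≤ 1`; (M3) NOT `G′_U`'s bounds ∕ (3.63)–(3.64)
(S3d), NOT `(Q′G′²Q′*)⁻¹` (S3c), NOT the tower.  [folklore] bookkeeping; «NE9 ⇐ the named binders»; NE9 NOT PRINTED ∕ NOT PROVED; NOT summit progress
(cell pub-balaban: spine PROVED 0/9; rung (B)+1 finite T⁴ — NOT infinite volume, NOT mass gap, NOT Clay; HONEST DEPENDENCY: continuum YM on T⁴ ⇐ BetaPertH
∧ nine spine estimates (0/9 proved); BetaPertH ⇐ (D1) ∧ (D4) ∧ CAP+tail; G-an2-4 gates asym, D1 and NE2/3/4).  Unit `b2b-balaban-t4-ne9-formalise-leaf-03`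
(gen 62), INTENT I-ne9leaf03-g62-4 (part 2); NEW file importing the parent only; modifies nothing.  Net new unproved facts: 0.
-/

noncomputable section

open scoped BigOperators InnerProductSpace ComplexConjugate

namespace Literature.MathematicalPhysics.QuantumFieldTheory.Balaban1983to89.B9Thm311SitePrimeFormCoerciveCanonical

open B4Sect5Torus (TSite)
open B9SectCLatticeCarrier (Bond shift)
open B9Eq311L2Pairing (WL2)
open B9Eq319QprimeTorus (fineP blockCoord mem_blockOf_iff)
open B11Eq103H1Complex (SiteL2K covDerivL2K equiv_covDerivL2K)
open B9Eq310HessianOperator (adTransportW)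
open B9Eq326OperatorAssembly (QprimeW)
open B9Eq3119DeltaPiCarrier (laplacePrimeA)
open B9Thm311DeltaPrimeA (re_inner_laplacePrimeA)
open B5Eq172HodgePositivity (adTransportW_one hRS_one)
open B5Eq172FlatCoercivity (card_blockOf)
open B9Eq319QprimeLipschitz (QprimeW_one_apply sum_norm_sq_QprimeW_sub_flat_le sum_blockOf_sum rho_nonneg)
open B9Eq373DerivativeRemainderL2 (norm_covDerivL2K_sub_le)
open B9Thm311SitePrimeFormCoercive (norm_sq_Qtilde_one flat_site_strong_coercive re_inner_laplacePrimeA_ge_flat_sub)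

variable {d : ℕ} (L : ℕ) [NeZero L] (m : Fin d → ℕ)

/-! ## §1 The `Q′`-letters in `laplacePrimeA`'s currency from (ρ′) and Jensen; §2 the strong site coercivity at a near-flat `U` -/

section Letters

variable {𝔸 : Type*} [Ring 𝔸] [Algebra ℂ 𝔸]
  {W : Type*} [NormedAddCommGroup W] [InnerProductSpace ℂ W] [FiniteDimensional ℂ W] (φ : W ≃ₗ[ℂ] 𝔸)
  {c₀ c₁ : ℝ} [Fact (0 < c₀)] [Fact (0 < c₁)] (U : Bond d (fineP L m) → 𝔸ˣ)

omit [FiniteDimensional ℂ W] in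
/-- **THE `Q′`-DEFECT IN THE `c₁`-CURRENCY**: `‖Q̃′(U)λ − Q̃′(1)λ‖ ≤ ρ′·√(c₁∕(c₀L^d))·‖λ‖`, `ρ′ = (1+ε)^{d(L−1)} − 1` — (ρ′)'s Hilbert letter
`B9Eq319QprimeLipschitz.sum_norm_sq_QprimeW_sub_flat_le` times the weight `c₁`; NO centre lift, NO `√(L^d)`; along `c₁(ηL)² = c₀L^d` the factor is
`(ηL)⁻¹`.  (The sharper flat sibling of ne9-leaf-06's two-background `B9Eq325RLipschitzResolvent.norm_Qtilde_sub_Qtilde_le` at `U′ ≡ 1`, which carries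
(ρ′)₂'s linear majorant.) [cite: Balaban1985BackgroundPropagators, (3.19) p.393, (3.24) p.394, p.403] -/
theorem norm_Qtilde_sub_flat_le {ε : ℝ} (hε : 0 ≤ ε) (hR : ∀ b w, ‖adTransportW φ U b w - w‖ ≤ ε * ‖w‖)
    (lam : SiteL2K ℂ d (fineP L m) c₀ W) :
    ‖((WL2.linearEquiv ℂ ℂ (fun _ : TSite d m => c₁)).symm.toLinearMap ∘ₗ QprimeW L m φ U) lam -
        ((WL2.linearEquiv ℂ ℂ (fun _ : TSite d m => c₁)).symm.toLinearMap ∘ₗ QprimeW L m φ (fun _ : Bond d (fineP L m) => (1 : 𝔸ˣ))) lam‖ ≤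
      ((1 + ε) ^ (d * (L - 1)) - 1) * Real.sqrt (c₁ / (c₀ * (L : ℝ) ^ d)) * ‖lam‖ := by
  have hc₀ : 0 < c₀ := Fact.out
  have hc₁ : 0 < c₁ := Fact.out
  have hLr : (0 : ℝ) < (L : ℝ) ^ d := pow_pos (by exact_mod_cast Nat.pos_of_ne_zero (NeZero.ne L)) d
  have hρ := rho_nonneg L (d := d) hε
  refine (pow_le_pow_iff_left₀ (norm_nonneg _) (by positivity) two_ne_zero).1 ?_
  have hsq : ‖((WL2.linearEquiv ℂ ℂ (fun _ : TSite d m => c₁)).symm.toLinearMap ∘ₗ QprimeW L m φ U) lam -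
        ((WL2.linearEquiv ℂ ℂ (fun _ : TSite d m => c₁)).symm.toLinearMap ∘ₗ QprimeW L m φ (fun _ : Bond d (fineP L m) => (1 : 𝔸ˣ))) lam‖ ^ 2 =
      c₁ * ∑ y, ‖QprimeW L m φ U (c₀ := c₀) lam y - QprimeW L m φ (fun _ => 1) (c₀ := c₀) lam y‖ ^ 2 := by
    rw [WL2.norm_sq (𝕜 := ℂ) (w := fun _ : TSite d m => c₁) (V := W), Finset.mul_sum]
    refine Finset.sum_congr rfl fun y _ => ?_
    rw [WL2.equiv_sub, Pi.sub_apply]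
    simp only [LinearMap.comp_apply, LinearEquiv.coe_coe, WL2.linearEquiv_symm_apply, Equiv.apply_symm_apply]
  rw [hsq]
  have h := sum_norm_sq_QprimeW_sub_flat_le L m φ U (c₀ := c₀) hε hR lam
  calc c₁ * ∑ y, ‖QprimeW L m φ U (c₀ := c₀) lam y - QprimeW L m φ (fun _ => 1) (c₀ := c₀) lam y‖ ^ 2
      ≤ c₁ * (((1 + ε) ^ (d * (L - 1)) - 1) ^ 2 * (((L : ℝ) ^ d * c₀)⁻¹ * ‖lam‖ ^ 2)) := mul_le_mul_of_nonneg_left h hc₁.le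
    _ = (((1 + ε) ^ (d * (L - 1)) - 1) * Real.sqrt (c₁ / (c₀ * (L : ℝ) ^ d)) * ‖lam‖) ^ 2 := by
        rw [mul_pow, mul_pow, Real.sq_sqrt (by positivity)]
        field_simp

omit [FiniteDimensional ℂ W] in
/-- **THE FLAT `Q̃′(1)` IS BOUNDED BY `√(c₁∕(c₀L^d))`** (Jensen on each block: `‖L^{−d}Σ_{B(y)}λ x‖² ≤ L^{−d}Σ_{B(y)}‖λ x‖²`, then the block
partition): `‖Q̃′(1)λ‖ ≤ √(c₁∕(c₀L^d))·‖λ‖`; along `c₁(ηL)² = c₀L^d` this is `(ηL)⁻¹`.  DEDUP NOTE: the same statement (up to `c₀·L^d` vs `L^d·c₀`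
under the root) is ne9-leaf-06's `B9Eq325RLipschitzResolvent.norm_Qtilde_one_le` (p336376, landed while this file was staged); kept here so that the
site-form files do not import the resolvent file (their consumer) — records hygiene, not a restatement of a cited result.
[cite: Balaban1985BackgroundPropagators, (3.19) p.393, (3.24) p.394; Balaban1985Averaging, (2) p.17] -/
theorem norm_Qtilde_flat_le (lam : SiteL2K ℂ d (fineP L m) c₀ W) :
    ‖((WL2.linearEquiv ℂ ℂ (fun _ : TSite d m => c₁)).symm.toLinearMap ∘ₗ QprimeW L m φ (fun _ : Bond d (fineP L m) => (1 : 𝔸ˣ))) lam‖ ≤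
      Real.sqrt (c₁ / (c₀ * (L : ℝ) ^ d)) * ‖lam‖ := by
  have hc₀ : 0 < c₀ := Fact.out
  have hc₁ : 0 < c₁ := Fact.out
  have hLr : (0 : ℝ) < (L : ℝ) ^ d := pow_pos (by exact_mod_cast Nat.pos_of_ne_zero (NeZero.ne L)) d
  refine (pow_le_pow_iff_left₀ (norm_nonneg _) (by positivity) two_ne_zero).1 ?_
  rw [norm_sq_Qtilde_one L m φ (c₀ := c₀) (c₁ := c₁) lam, mul_pow, Real.sq_sqrt (by positivity)]
  set g := WL2.equiv ℂ (fun _ : TSite d (fineP L m) => c₀) W lam with hg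
  have hl : ‖lam‖ ^ 2 = c₀ * ∑ x, ‖g x‖ ^ 2 := by
    rw [WL2.norm_sq (𝕜 := ℂ) (w := fun _ : TSite d (fineP L m) => c₀) (V := W), Finset.mul_sum]
  -- Jensen per block
  have hJ : ∀ y, ‖((L : ℝ) ^ d)⁻¹ • ∑ x ∈ B9Eq319QprimeTorus.blockOf L m y, g x‖ ^ 2 ≤ ((L : ℝ) ^ d)⁻¹ * ∑ x ∈ B9Eq319QprimeTorus.blockOf L m y, ‖g x‖ ^ 2 := fun y => by
    have h1 : ‖((L : ℝ) ^ d)⁻¹ • ∑ x ∈ B9Eq319QprimeTorus.blockOf L m y, g x‖ ≤ ((L : ℝ) ^ d)⁻¹ * ∑ x ∈ B9Eq319QprimeTorus.blockOf L m y, ‖g x‖ := by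
      rw [norm_smul, norm_inv, norm_pow, Real.norm_natCast]
      exact mul_le_mul_of_nonneg_left (norm_sum_le _ _) (by positivity)
    exact (pow_le_pow_left₀ (norm_nonneg _) h1 2).trans (B9Eq319QprimeLipschitz.blockMean_norm_sq_le L m g y)
  calc c₁ * ∑ y, ‖((L : ℝ) ^ d)⁻¹ • ∑ x ∈ B9Eq319QprimeTorus.blockOf L m y, g x‖ ^ 2
      ≤ c₁ * ∑ y, ((L : ℝ) ^ d)⁻¹ * ∑ x ∈ B9Eq319QprimeTorus.blockOf L m y, ‖g x‖ ^ 2 := mul_le_mul_of_nonneg_left (Finset.sum_le_sum fun y _ => hJ y) hc₁.le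
    _ = c₁ * (((L : ℝ) ^ d)⁻¹ * ∑ x, ‖g x‖ ^ 2) := by rw [← Finset.mul_sum, sum_blockOf_sum]
    _ = c₁ / (c₀ * (L : ℝ) ^ d) * ‖lam‖ ^ 2 := by rw [hl]; field_simp

variable {η : ℝ} {a' : ℝ} (ha' : 0 < a')
  (hRS : ∀ (b : Bond d (fineP L m)) (v u : W), ⟪adTransportW φ U b v, u⟫_ℂ = ⟪v, adTransportW φ (fun b => (U b)⁻¹) b u⟫_ℂ)
  {εR : ℝ} (hεR : 0 ≤ εR) (hRε : ∀ (b : Bond d (fineP L m)) (w : W), ‖adTransportW φ U b w - w‖ ≤ εR * ‖w‖)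

include ha' hRS hεR hRε

/-- **THE STRONG SITE COERCIVITY AT A NEAR-FLAT BACKGROUND, FORM-RELATIVE, ALONG BAŁABAN's NORMALISATION** (`c₁(ηL)² = c₀L^d`, `0 < ηL ≤ 1`,
transporters `εR`-close to the identity, `hRS`): with `t := ‖η⁻¹‖·εR`, `ρ′ := (1+εR)^{d(L−1)} − 1`, `s := (ηL)⁻¹`,
`(1∕(2 + 2∕a′) − θ′)·(‖D_1λ‖² + s²‖λ‖²) ≤ re⟨λ, Δ′_{a′}(U)λ⟩`, `θ′ = √d·t + d·t² + a′·ρ′s·(2s + ρ′s)` — §2 + §3 with `δ_D = √d·t`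
(`norm_covDerivL2K_sub_le`), `δ_{Q′} = ρ′s`, `M_{Q′} = s` (§4).  On the diagonal `ηL = 1` at `εR = K_Rαη`: `t = K_Rα`, `ρ′ ≤ dK_Rα·e^{dK_Rα}` — NO
`η`, `L`, `m`, `c₀`, `c₁`, NO `√(L^d)`.  The `G′_U`-bounds and (3.63)–(3.64) are S3d's (not here).
[cite: Balaban1985BackgroundPropagators, (3.24)–(3.25) p.394, (3.63)–(3.64) p.402, Thm 3.11 p.416; Balaban1983RegularityDecay, (2.27) p.580] -/
theorem strong_site_coercive_canonical (hηL0 : 0 < η * L) (hηL1 : η * L ≤ 1) (hs : c₁ * (η * L) ^ 2 = c₀ * (L : ℝ) ^ d)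
    (lam : SiteL2K ℂ d (fineP L m) c₀ W) :
    (1 / (2 + 2 / a') -
        (Real.sqrt d * (‖((η : ℂ))⁻¹‖ * εR) + (Real.sqrt d * (‖((η : ℂ))⁻¹‖ * εR)) ^ 2 +
          a' * (((1 + εR) ^ (d * (L - 1)) - 1) * (η * L)⁻¹) * (2 * (η * L)⁻¹ + ((1 + εR) ^ (d * (L - 1)) - 1) * (η * L)⁻¹))) *
        (‖covDerivL2K ℂ c₀ ((η : ℂ))⁻¹ (adTransportW φ (fun _ : Bond d (fineP L m) => (1 : 𝔸ˣ))) lam‖ ^ 2 + ((η * L)⁻¹) ^ 2 * ‖lam‖ ^ 2) ≤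
      RCLike.re ⟪lam, laplacePrimeA L m φ η U a' (c₁ := c₁) lam⟫_ℂ := by
  have hc₀ : 0 < c₀ := Fact.out
  have hc₁ : 0 < c₁ := Fact.out
  have hLr : (0 : ℝ) < L := by exact_mod_cast Nat.pos_of_ne_zero (NeZero.ne L)
  have hη0 : 0 < η := pos_of_mul_pos_left hηL0 hLr.le
  have hη : η ≠ 0 := hη0.ne'
  have hc : conj (((η : ℂ))⁻¹) = ((η : ℂ))⁻¹ := B5Eq172HodgePositivity.conj_inv_ofReal η
  have hρ := rho_nonneg L (d := d) hεR
  -- the weight factor `√(c₁/(c₀L^d)) = (ηL)⁻¹`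
  have hratio : Real.sqrt (c₁ / (c₀ * (L : ℝ) ^ d)) = (η * L)⁻¹ := by
    have h1 : c₁ / (c₀ * (L : ℝ) ^ d) = ((η * L)⁻¹) ^ 2 := by
      rw [← hs]; field_simp
    rw [h1, Real.sqrt_sq (by positivity)]
  -- the three letters
  have hR₁ : ∀ (b : Bond d (fineP L m)) (w : W), adTransportW φ (fun _ : Bond d (fineP L m) => (1 : 𝔸ˣ)) b w = w := fun b w => by
    rw [adTransportW_one]; rfl
  have hDl : ∀ l : SiteL2K ℂ d (fineP L m) c₀ W, ‖covDerivL2K ℂ c₀ ((η : ℂ))⁻¹ (adTransportW φ U) l -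
      covDerivL2K ℂ c₀ ((η : ℂ))⁻¹ (adTransportW φ (fun _ : Bond d (fineP L m) => (1 : 𝔸ˣ))) l‖ ≤ Real.sqrt d * (‖((η : ℂ))⁻¹‖ * εR) * ‖l‖ :=
    fun l => (norm_covDerivL2K_sub_le _ hεR hRε hR₁ l).trans (le_of_eq (by ring))
  have hQl := fun l : SiteL2K ℂ d (fineP L m) c₀ W => norm_Qtilde_sub_flat_le L m φ (c₀ := c₀) (c₁ := c₁) U hεR hRε l
  have hQ1 := fun l : SiteL2K ℂ d (fineP L m) c₀ W => norm_Qtilde_flat_le L m φ (c₀ := c₀) (c₁ := c₁) (𝔸 := 𝔸) l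
  simp only [hratio] at hQl hQ1
  have hnear := re_inner_laplacePrimeA_ge_flat_sub L m φ (c₁ := c₁) η ha'.le U hRS (by positivity) (by positivity) hDl hQl hQ1 lam
  have hflat := flat_site_strong_coercive L m φ (c₁ := c₁) hη ha' hηL0 hs lam
  -- `(ηL)⁻² ≥ 1` converts the `‖λ‖²`-row defect into the scaled row
  have hinv : (1 : ℝ) ≤ ((η * L)⁻¹) ^ 2 := by
    have h1le : (1 : ℝ) ≤ (η * L)⁻¹ := one_le_inv_iff₀.mpr ⟨hηL0, hηL1⟩
    nlinarith
  have hd0 : (0 : ℝ) ≤ Real.sqrt d := Real.sqrt_nonneg _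
  have ht0 : 0 ≤ ‖((η : ℂ))⁻¹‖ * εR := mul_nonneg (norm_nonneg _) hεR
  have hs0 : 0 ≤ (η * L)⁻¹ := by positivity
  have hD0 : 0 ≤ ‖covDerivL2K ℂ c₀ ((η : ℂ))⁻¹ (adTransportW φ (fun _ : Bond d (fineP L m) => (1 : 𝔸ˣ))) lam‖ ^ 2 := sq_nonneg _
  have hl0 : 0 ≤ ‖lam‖ ^ 2 := sq_nonneg _
  set θ : ℝ := Real.sqrt d * (‖((η : ℂ))⁻¹‖ * εR) + (Real.sqrt d * (‖((η : ℂ))⁻¹‖ * εR)) ^ 2 +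
      a' * (((1 + εR) ^ (d * (L - 1)) - 1) * (η * L)⁻¹) * (2 * (η * L)⁻¹ + ((1 + εR) ^ (d * (L - 1)) - 1) * (η * L)⁻¹) with hθ
  set D : ℝ := ‖covDerivL2K ℂ c₀ ((η : ℂ))⁻¹ (adTransportW φ (fun _ : Bond d (fineP L m) => (1 : 𝔸ˣ))) lam‖ ^ 2 with hDdef
  set X : ℝ := ‖lam‖ ^ 2 with hXdef
  have hθ0 : 0 ≤ θ := by rw [hθ]; positivity
  -- the derivative-row coefficient `√d·t ≤ θ`, and `θ·X ≤ θ·(ηL)⁻²·X`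
  have h1 : Real.sqrt d * (‖((η : ℂ))⁻¹‖ * εR) * D ≤ θ * D := by
    refine mul_le_mul_of_nonneg_right ?_ hD0
    rw [hθ]
    have : 0 ≤ (Real.sqrt d * (‖((η : ℂ))⁻¹‖ * εR)) ^ 2 +
        a' * (((1 + εR) ^ (d * (L - 1)) - 1) * (η * L)⁻¹) * (2 * (η * L)⁻¹ + ((1 + εR) ^ (d * (L - 1)) - 1) * (η * L)⁻¹) := by positivity
    linarith
  have h2 : θ * X ≤ θ * (((η * L)⁻¹) ^ 2 * X) := mul_le_mul_of_nonneg_left (le_mul_of_one_le_left hl0 hinv) hθ0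
  have e : (1 / (2 + 2 / a') - θ) * (D + ((η * L)⁻¹) ^ 2 * X) =
      1 / (2 + 2 / a') * (D + ((η * L)⁻¹) ^ 2 * X) - θ * D - θ * (((η * L)⁻¹) ^ 2 * X) := by ring
  rw [e]
  have hn' : RCLike.re ⟪lam, laplacePrimeA L m φ η (fun _ : Bond d (fineP L m) => (1 : 𝔸ˣ)) a' (c₁ := c₁) lam⟫_ℂ -
      (Real.sqrt d * (‖((η : ℂ))⁻¹‖ * εR) * D + θ * X) ≤ RCLike.re ⟪lam, laplacePrimeA L m φ η U a' (c₁ := c₁) lam⟫_ℂ := by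
    rw [hθ, hDdef, hXdef]; exact hnear
  linarith [hn', hflat, h1, h2]

end Letters

end Literature.MathematicalPhysics.QuantumFieldTheory.Balaban1983to89.B9Thm311SitePrimeFormCoerciveCanonical

end
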